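import Mathlib
import Literature.Computability.AlgebraicComplexity.Hyperdeterminant
import Literature.Computability.AlgebraicComplexity.Apolarity
import Summits.ValiantsHypothesis.ValiantsHypothesis.Theorems.BorderApolarityBorelFixedBorderApolarityLowering
import Summits.ValiantsHypothesis.ValiantsHypothesis.Theorems.BorderApolarityToricFixedPointsCellRetractionAux2

/-!
# Crux `DetQP.DetqpThesis` (stmt-ValiantsHypothesis-0315), line `four-dimensional-determinant` —
# the group `H(n,m,ι)` of the padded four-dimensional determinant: triangularity and torus stability

Helper file for stub `stub_borelFixed_of_parts` (B2d; `Theorems/DetQPDetqpThesisHyperdetBorelFixed.lean`).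
`H(n,m,ι) ⊆ GL_{m²}`: substitutions whose used block (columns/rows `ι I`, `I : Fin 4 → Fin n`) is
a Kronecker product of four upper triangular `a_r`, padding column `X₀₀ ↦ λ X₀₀`, unused columns
triangular for the order `p.1·m + p.2` plus anything in the used/padding rows.  Here:

* `hdbf_shape_lower` — an `H`-shaped `M` RAISES every anti-dominant weight `μ` (clauses (2)(i)–(iii)
  of stub B2w) off the diagonal: `M b a ≠ 0`, `a ≠ b` ⇒ `μ a < μ b`;
* `hdbf_shape_blockTriangular`, `hdbf_shape_det` — hence `Mᵀ` is block triangular for an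
  injective such `μ` and `det M = ∏ diagonal` (`bfba_det_eq_prod_diag`);
* `hdbf_unip_diag` — the unipotent class (unit `a_r`, `λ = 1`, unit unused diagonal) has unit diagonal;
* `hdbf_torus_stable` — a `μ`-graded subspace of degree-`k` forms, `k ≤ m`, is stable under
  `diag(d)` for every nowhere-zero `d` of `H`-diagonal pattern `d(ιI) = ∏_r t_r(I_r)`, by the
  genericity clause (4) of B2w (general form of `bfba_torus_stable`).

Adapted from `Theorems/BorderApolarityBorelFixedBorderApolarityLowering.lean` (route BorderApolarity,
item 5781).  Folklore linear algebra.
-/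

open MvPolynomial Filter
open scoped BigOperators Topology Matrix

namespace Summit.ValiantsHypothesis.ValiantsHypothesis.Theorems.DetQPDetqpThesis.HdBorelFixed

set_option linter.dupNamespace false

open Literature.Computability.AlgebraicComplexity
open Summit.ValiantsHypothesis.ValiantsHypothesis.Theorems.BorderApolarityToricFixedPoints
open Summit.ValiantsHypothesis.ValiantsHypothesis.Theorems.BorderApolarityBorelFixedBorderApolarity

variable {n m : ℕ}

/-! ## `H`-shaped matrices raise the weight; determinant = product of the diagonal -/

section Shape

variable [NeZero m] (ι : (Fin 4 → Fin n) → Fin m × Fin m) (μ : Fin m × Fin m → ℤ)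

/-- **`H`-shaped substitutions raise `μ` off the diagonal.**  If the used block of `M` is a
Kronecker product of upper triangular matrices, the used columns vanish outside the used rows, the
padding column is diagonal and the unused block is triangular for `p.1·m + p.2`, then
`M b a ≠ 0`, `a ≠ b` forces `μ a < μ b` for every anti-dominant `μ` (clauses (2)(i)–(iii) of B2w). -/
theorem hdbf_shape_lower
    (h2i : ∀ I I' : Fin 4 → Fin n, (∀ r, I' r ≤ I r) → I ≠ I' → μ (ι I) < μ (ι I'))
    (h2a : ∀ p : Fin m × Fin m, p ∉ Set.range ι → p ≠ (0, 0) → ∀ I : Fin 4 → Fin n, μ p < μ (ι I))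
    (h2b : ∀ p : Fin m × Fin m, p ∉ Set.range ι → p ≠ (0, 0) → μ p < μ (0, 0))
    (h2c : ∀ p q : Fin m × Fin m, p ∉ Set.range ι → p ≠ (0, 0) → q ∉ Set.range ι → q ≠ (0, 0) →
      (p.1 : ℕ) * m + (p.2 : ℕ) < (q.1 : ℕ) * m + (q.2 : ℕ) → μ q < μ p)
    (M : Matrix (Fin m × Fin m) (Fin m × Fin m) ℂ)
    (hM1 : ∃ a : Fin 4 → Matrix (Fin n) (Fin n) ℂ,
      (∀ (r : Fin 4) (i j : Fin n), j < i → a r i j = 0) ∧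
      (∀ I I' : Fin 4 → Fin n, M (ι I') (ι I) = ∏ r, a r (I' r) (I r)))
    (hM2 : ∀ (I : Fin 4 → Fin n) (p : Fin m × Fin m), p ∉ Set.range ι → M p (ι I) = 0)
    (hM3 : ∀ p : Fin m × Fin m, p ≠ (0, 0) → M p (0, 0) = 0)
    (hM4 : ∀ p q : Fin m × Fin m, p ∉ Set.range ι → p ≠ (0, 0) → q ∉ Set.range ι → q ≠ (0, 0) →
      (p.1 : ℕ) * m + (p.2 : ℕ) < (q.1 : ℕ) * m + (q.2 : ℕ) → M q p = 0) :
    ∀ a b : Fin m × Fin m, a ≠ b → M b a ≠ 0 → μ a < μ b := by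
  intro a b hab hne
  by_cases ha : a ∈ Set.range ι
  · obtain ⟨I, rfl⟩ := ha
    by_cases hb : b ∈ Set.range ι
    · obtain ⟨I', rfl⟩ := hb
      obtain ⟨aa, htri, hent⟩ := hM1
      rw [hent I I'] at hne
      have hle : ∀ r, I' r ≤ I r := by
        intro r
        by_contra hlt
        push Not at hlt
        exact hne (Finset.prod_eq_zero (Finset.mem_univ r) (htri r (I' r) (I r) hlt))
      have hII' : I ≠ I' := fun h => hab (by rw [h])
      exact h2i I I' hle hII'
    · exact absurd (hM2 I b hb) hne
  · by_cases ha0 : a = (0, 0)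
    · subst ha0
      exact absurd (hM3 b (Ne.symm hab)) hne
    · by_cases hb : b ∈ Set.range ι
      · obtain ⟨I', rfl⟩ := hb
        exact h2a a ha ha0 I'
      · by_cases hb0 : b = (0, 0)
        · subst hb0
          exact h2b a ha ha0
        · rcases lt_trichotomy ((a.1 : ℕ) * m + (a.2 : ℕ)) ((b.1 : ℕ) * m + (b.2 : ℕ)) with hlt | heq | hgt
          · exact absurd (hM4 a b ha ha0 hb hb0 hlt) hne
          · exact absurd (bfba_lin_injective a b heq) hab
          · exact h2c b a hb hb0 ha ha0 hgt

/-- The transpose of an `H`-shaped matrix is block triangular for `μ`. -/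
theorem hdbf_shape_blockTriangular
    (h2i : ∀ I I' : Fin 4 → Fin n, (∀ r, I' r ≤ I r) → I ≠ I' → μ (ι I) < μ (ι I'))
    (h2a : ∀ p : Fin m × Fin m, p ∉ Set.range ι → p ≠ (0, 0) → ∀ I : Fin 4 → Fin n, μ p < μ (ι I))
    (h2b : ∀ p : Fin m × Fin m, p ∉ Set.range ι → p ≠ (0, 0) → μ p < μ (0, 0))
    (h2c : ∀ p q : Fin m × Fin m, p ∉ Set.range ι → p ≠ (0, 0) → q ∉ Set.range ι → q ≠ (0, 0) →
      (p.1 : ℕ) * m + (p.2 : ℕ) < (q.1 : ℕ) * m + (q.2 : ℕ) → μ q < μ p)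
    (M : Matrix (Fin m × Fin m) (Fin m × Fin m) ℂ)
    (hM1 : ∃ a : Fin 4 → Matrix (Fin n) (Fin n) ℂ,
      (∀ (r : Fin 4) (i j : Fin n), j < i → a r i j = 0) ∧
      (∀ I I' : Fin 4 → Fin n, M (ι I') (ι I) = ∏ r, a r (I' r) (I r)))
    (hM2 : ∀ (I : Fin 4 → Fin n) (p : Fin m × Fin m), p ∉ Set.range ι → M p (ι I) = 0)
    (hM3 : ∀ p : Fin m × Fin m, p ≠ (0, 0) → M p (0, 0) = 0)
    (hM4 : ∀ p q : Fin m × Fin m, p ∉ Set.range ι → p ≠ (0, 0) → q ∉ Set.range ι → q ≠ (0, 0) →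
      (p.1 : ℕ) * m + (p.2 : ℕ) < (q.1 : ℕ) * m + (q.2 : ℕ) → M q p = 0) :
    Mᵀ.BlockTriangular μ := by
  intro i j hij
  rw [Matrix.transpose_apply]
  by_contra h
  have hne : i ≠ j := fun heq => by rw [heq] at hij; exact lt_irrefl _ hij
  have hlt := hdbf_shape_lower ι μ h2i h2a h2b h2c M hM1 hM2 hM3 hM4 i j hne h
  exact lt_asymm hij hlt

/-- **`det = ∏ diagonal`** for an `H`-shaped matrix and an injective anti-dominant `μ`. -/
theorem hdbf_shape_det (hμ : Function.Injective μ)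
    (h2i : ∀ I I' : Fin 4 → Fin n, (∀ r, I' r ≤ I r) → I ≠ I' → μ (ι I) < μ (ι I'))
    (h2a : ∀ p : Fin m × Fin m, p ∉ Set.range ι → p ≠ (0, 0) → ∀ I : Fin 4 → Fin n, μ p < μ (ι I))
    (h2b : ∀ p : Fin m × Fin m, p ∉ Set.range ι → p ≠ (0, 0) → μ p < μ (0, 0))
    (h2c : ∀ p q : Fin m × Fin m, p ∉ Set.range ι → p ≠ (0, 0) → q ∉ Set.range ι → q ≠ (0, 0) →
      (p.1 : ℕ) * m + (p.2 : ℕ) < (q.1 : ℕ) * m + (q.2 : ℕ) → μ q < μ p)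
    (M : Matrix (Fin m × Fin m) (Fin m × Fin m) ℂ)
    (hM1 : ∃ a : Fin 4 → Matrix (Fin n) (Fin n) ℂ,
      (∀ (r : Fin 4) (i j : Fin n), j < i → a r i j = 0) ∧
      (∀ I I' : Fin 4 → Fin n, M (ι I') (ι I) = ∏ r, a r (I' r) (I r)))
    (hM2 : ∀ (I : Fin 4 → Fin n) (p : Fin m × Fin m), p ∉ Set.range ι → M p (ι I) = 0)
    (hM3 : ∀ p : Fin m × Fin m, p ≠ (0, 0) → M p (0, 0) = 0)
    (hM4 : ∀ p q : Fin m × Fin m, p ∉ Set.range ι → p ≠ (0, 0) → q ∉ Set.range ι → q ≠ (0, 0) →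
      (p.1 : ℕ) * m + (p.2 : ℕ) < (q.1 : ℕ) * m + (q.2 : ℕ) → M q p = 0) :
    M.det = ∏ a, M a a := by
  rw [← Matrix.det_transpose,
    bfba_det_eq_prod_diag μ hμ Mᵀ (hdbf_shape_blockTriangular ι μ h2i h2a h2b h2c M hM1 hM2 hM3 hM4)]
  rfl

end Shape

/-! ## The unipotent class `U` of `H(n,m,ι)` -/

section Unipotent

variable [NeZero m] (ι : (Fin 4 → Fin n) → Fin m × Fin m)

/-- Elements of the unipotent class have unit diagonal. -/
theorem hdbf_unip_diag (M : Matrix (Fin m × Fin m) (Fin m × Fin m) ℂ)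
    (hU1 : ∃ a : Fin 4 → Matrix (Fin n) (Fin n) ℂ,
      (∀ (r : Fin 4) (i j : Fin n), j < i → a r i j = 0) ∧ (∀ (r : Fin 4) (i : Fin n), a r i i = 1) ∧
      (∀ I I' : Fin 4 → Fin n, M (ι I') (ι I) = ∏ r, a r (I' r) (I r)))
    (hU5 : M (0, 0) (0, 0) = 1)
    (hU6 : ∀ p : Fin m × Fin m, p ∉ Set.range ι → p ≠ (0, 0) → M p p = 1) :
    ∀ a, M a a = 1 := by
  intro a
  by_cases ha : a ∈ Set.range ι
  · obtain ⟨I, rfl⟩ := ha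
    obtain ⟨aa, -, hdiag, hent⟩ := hU1
    rw [hent I I]
    exact Finset.prod_eq_one fun r _ => hdiag r (I r)
  · by_cases ha0 : a = (0, 0)
    · rw [ha0]; exact hU5
    · exact hU6 a ha ha0

end Unipotent

/-! ## Torus stability of graded subspaces under `H`-diagonal patterns -/

/-- **Torus stability of graded subspaces.**  If `μ` has the genericity property (clause (4) of
B2w), a `μ`-graded subspace `L` of degree-`k` forms, `k ≤ m`, is stable under `diag(d)` for every
nowhere-zero `d` of `H`-diagonal pattern `d(ιI) = ∏_r t_r(I_r)`: on a weight component all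
monomials have the same character `∏ d_v^{e_v}`, so `diag(d)` acts on it by a scalar. -/
theorem hdbf_torus_stable (ι : (Fin 4 → Fin n) → Fin m × Fin m) (μ : Fin m × Fin m → ℤ)
    (hμ4 : ∀ e e' : Fin m × Fin m →₀ ℕ, e.degree ≤ m → e'.degree ≤ m →
        Finsupp.weight μ e = Finsupp.weight μ e' →
        ∀ d : Fin m × Fin m → ℂ, (∀ v, d v ≠ 0) →
          (∃ t : Fin 4 → Fin n → ℂ, ∀ I : Fin 4 → Fin n, d (ι I) = ∏ r, t r (I r)) →
          ∏ v ∈ e.support, d v ^ e v = ∏ v ∈ e'.support, d v ^ e' v)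
    (k : ℕ) (hk : k ≤ m) (L : Submodule ℂ (MvPolynomial (Fin m × Fin m) ℂ))
    (hL : L ≤ homogeneousSubmodule (Fin m × Fin m) ℂ k)
    (hgr : ∀ D ∈ L, ∀ ν : ℤ, weightedHomogeneousComponent μ ν D ∈ L)
    (d : Fin m × Fin m → ℂ) (hd : ∀ v, d v ≠ 0)
    (hpat : ∃ t : Fin 4 → Fin n → ℂ, ∀ I : Fin 4 → Fin n, d (ι I) = ∏ r, t r (I r)) :
    ∀ D ∈ L, linSubst (Fin m × Fin m) ℂ (Matrix.diagonal d) D ∈ L := by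
  classical
  intro D hD
  rw [← cr_sum_comp (μ := μ) D, map_sum]
  refine L.sum_mem fun ν' _ => ?_
  set G := weightedHomogeneousComponent μ ν' D with hG
  have hGL : G ∈ L := hgr D hD ν'
  have hGhom : G.IsHomogeneous k := (mem_homogeneousSubmodule k G).1 (hL hGL)
  have hGwt : ∀ e ∈ G.support, Finsupp.weight μ e = ν' := by
    intro e he
    rw [mem_support_iff, hG, coeff_weightedHomogeneousComponent] at he
    by_contra h
    exact he (if_neg h)
  have hGdeg : ∀ e ∈ G.support, e.degree = k := by
    intro e he
    rw [Finsupp.degree_eq_weight_one]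
    exact hGhom (mem_support_iff.1 he)
  by_cases hG0 : G = 0
  · rw [hG0, map_zero]; exact L.zero_mem
  obtain ⟨e₀, he₀⟩ := Finset.nonempty_of_ne_empty (mt support_eq_empty.1 hG0)
  set χ : ℂ := ∏ v ∈ e₀.support, d v ^ e₀ v with hχ
  have hscal : linSubst (Fin m × Fin m) ℂ (Matrix.diagonal d) G = χ • G := by
    ext e
    rw [tli_coeff_linSubst_diagonal, coeff_smul, smul_eq_mul]
    by_cases he : e ∈ G.support
    · rw [hμ4 e e₀ ((hGdeg e he).le.trans hk) ((hGdeg e₀ he₀).le.trans hk)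
        ((hGwt e he).trans (hGwt e₀ he₀).symm) d hd hpat]
    · rw [notMem_support_iff.1 he, mul_zero, mul_zero]
  rw [hscal]
  exact L.smul_mem χ hGL


end Summit.ValiantsHypothesis.ValiantsHypothesis.Theorems.DetQPDetqpThesis.HdBorelFixed
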